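import Summits.ABC.IUTFork.Cor312HullDefinedDHVolArch
import Literature.IUT.LogVolume.ArchimedeanPacketHull
import HarnessLib

/-!
# [IUTchIII] Corollary 3.12, statement — the ARCHIMEDEAN local Θ-term of the real setting with the verbatim
# volumes and an honest archimedean place: `^{n,∘}𝒰_{j,∞} = e⁻¹(π^{j+1}·B_I)` and `thetaLocal j ∞ = (j+1)·log π`

Record-only file (D-0012) of the abc-iut cell (wave-5 prover seat abc-iut-w5-d163 gen 2; TEAM A row A-0 NAMED
LEFTOVER (4) «archimedean radial container vs DH convention», sequel of `Cor312HullDefinedDHVolArch`); TAKES NO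
SIDE on [IUTchIII] Cor. 3.12. [IUTchIV] Thm. 1.10, proof, Step (vii), kurims `paper:url-56bcb0f95768` p. 30: at
`v_ℚ ∈ 𝕍^arc_ℚ` "it follows from Proposition 1.5, (iii), (iv), that `π^{j+1}·B_I` serves as a container for the
union of possible images of a Θ-pilot object … an upper bound `(j+1)·log(π)`". abc-iut-L5-t7's
`ArchimedeanPacketHull` proved the HULL FORM on the real archimedean packet `M_I`: every region `U ⊆ π^{|I|}·B_I`
containing the tensor `⊗_i (π)_v` of maximal-length shell elements has holomorphic hull EXACTLY `π^{|I|}·B_I`, of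
normalised log-volume `|I|·log π`. THIS file reads that theorem AT THE ASSEMBLED REAL SETTING `Real.settingDHVolArch`
(`Cor312SettingDHVolArch`: c312-7's per-frame assembler over the real log-shells of `F` with the verbatim
container and the honest archimedean place): if at `(j, ∞)` the Θ-boxes of the Θ-pilot object (the binder
`thetaBox`, in the coordinates `⊕_{(w,ε)} ℂ` of the canonical decomposition `Φ₀`) lie in the polydisc of radius
`π^{j+1}` (= `Φ₀(π^{j+1}·B_I)`) and contain the point `Φ₀(⊗_i (π)_v)`, then

* `hullDefined_settingDHVolArch_inl_of_container` — `HullDefined j ∞` (boundedness from the container,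
  nondegeneracy from the point, whose coordinates have norm `π^{j+1} ≠ 0`);
* **`thetaHull_settingDHVolArch_inl`** — the hull `^{n,∘}𝒰_{j,∞}` of the union of ALL possible images of the
  Θ-pilot object IS `e⁻¹(π^{j+1}·B_I)` (the whole (Ind1)/(Ind2)-orbit stays in `e⁻¹(π^{j+1}·B_I)` by p418920's
  `family_image_ballPk`; then L5-t7 `holomorphicHull_image_eq`);
* **`thetaLocal_settingDHVolArch_inl`** — `thetaLocal j ∞ = |S^±_{j+1}|·log π = (j+1)·log π` — the archimedean term
  that the trivial container of `Cor312VolumesRealAssembly` set to `0`, now a KERNEL IDENTITY at the assembled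
  setting (p418570 `Real.logvol_thetaContainer_arch`).
[claim: Mochizuki2012, status: disputed] for the quoted sentences; the mathematics is L5-t7's (classical).
Deliberately NOT here: which Θ-boxes the genuine Θ-pilot object has at `∞` (binder; [IUTchIV] Step (vii) says the
possible images are "the elements of `M_I` obtained by forming the tensor product of elements of the log-shells"
— supplying a `thetaBox` with the two properties is the box provider's one line), `ThetaFinite`, any judgement.
-/

noncomputable section

open Set Function NumberField IsDedekindDomain Bornology
open scoped Pointwise

namespace Summit.ABC

namespace IUTFork

namespace Thm311

namespace Real

open Cor312 Cor312Vol Literature.IUT.LogThetaLattice Literature.IUT.LogVolume Literature.IUT.LogVolume.Prop15iii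
  PiTensorProduct

attribute [local instance] Cor312Vol.ArchPresentation.fibreFintype

variable {F : Type} [Field F] [NumberField F] (X : PilotData F) {logv : PadicLogs F} (hlog : LogvAnalytic logv)
  (hc : ∀ w : InfinitePlace F, w.IsComplex)

section Setting

variable (M : Type) [Field M] [NumberField M]
  (archPk : ∀ (j : (thetaIndex X).Label) (vQ : (thetaIndex X).VQ), Set ((logShellsDH X logv).Packet j vQ))
  (archSub : ∀ (j : (thetaIndex X).Label) (v : (thetaIndex X).V),
    Set ((logShellsDH X logv).Packet j ((thetaIndex X).over v)))
  (Ψ : ℤ → ∀ v : (thetaIndex X).V, v ∈ (thetaIndex X).Vbad → Set ((logShellsDH X logv).StarPacket v))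
  (act : ℤ → ∀ v : (thetaIndex X).V, v ∈ (thetaIndex X).Vbad →
    (logShellsDH X logv).StarPacket v → Module.End ℚ ((logShellsDH X logv).StarPacket v))
  (Mmod : ℤ → ∀ j : (thetaIndex X).LabelStar, Set ((logShellsDH X logv).GlobalPacket j.1))
  (region : ℤ → ∀ j : (thetaIndex X).LabelStar, FinDivisor M → ∀ vQ : (thetaIndex X).VQ,
    Set ((logShellsDH X logv).Packet j.1 vQ))
  (n : ℤ) {HT : Type} {LogLink : HT → HT → Type} {IsFull : ∀ {s t : HT}, LogLink s t → Prop}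
  (lat : LGPGaussianLogThetaLattice LogLink IsFull)
  {Frd : Type} {IsoF : Frd → Frd → Type} {Ob : Frd → Type} {realify : Frd → Frd} {Strip : Type}
  {IsoS : Strip → Strip → Type} {Mv : ∀ v : (thetaIndex X).V, v ∈ (thetaIndex X).Vbad → Type}
  [∀ v h, Monoid (Mv v h)]
  (sig : GlobalLGPFrobenioidSignature (thetaIndex X).lstar (thetaIndex X).V (· ∈ (thetaIndex X).Vbad)
    Frd IsoF Ob realify Strip IsoS Mv)
  (split : SplittingMonoids Mv) {ObΔ : Type} {N : ∀ v : (thetaIndex X).V, v ∈ (thetaIndex X).Vbad → Type}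
  [∀ v h, Monoid (N v h)] (qData : QPilotData ObΔ N)
  (thetaBox : ℤ → Ob sig.Clgp → ∀ (j : (thetaIndex X).Label) (vQ : (thetaIndex X).VQ),
    Set (∀ s : factorIdxDHArch X hlog j vQ, factorFieldDHArch X hlog j vQ s))
  (qCentre : ObΔ → ∀ (j : (thetaIndex X).Label) (vQ : (thetaIndex X).VQ),
    ∀ s : factorIdxDHArch X hlog j vQ, factorFieldDHArch X hlog j vQ s)
  (hq : ∀ j vQ s, qCentre (qPilotObject qData) j vQ s ≠ 0)
  (hfin : ∀ j : (thetaIndex X).Label, (Function.support fun vQ =>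
    ((situationDHVolArch X hlog hc M archPk archSub Ψ act Mmod region).D n).logvol j vQ
      (factorMapDHArch X hlog hc j vQ ⁻¹' hullSet (factorFieldDHArch X hlog j vQ)
        (qCentre (qPilotObject qData) j vQ))).Finite)

/-- The Step (vii) CONTAINER in the coordinates `⊕_{(w,ε)} ℂ`: the polydisc of common radius `π^{|S^±_{j+1}|}`
(= `Φ₀(π^{j+1}·B_I)`, L5-t7 `image_pi_pow_smul_ball`). [claim: Mochizuki2012, status: disputed] -/
abbrev archContainer (j : (thetaIndex X).Label) :
    Set (∀ s : factorIdxDHArch X hlog j (.inl ()), factorFieldDHArch X hlog j (.inl ()) s) :=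
  Literature.IUT.LogVolume.polydisc (fun _ : ArchPresentation.J (T := thetaIndex X) (Sum.inl ()) j => ℂ)
    fun _ => Real.pi ^ Fintype.card ((thetaIndex X).Caps j)

/-- The container is L5-t7's `ArchPacket.polydisc` of common radius `π^{|I|}` (same set, `polydisc_eq_pi`). [folklore] -/
theorem archContainer_eq_archPacket (j : (thetaIndex X).Label) :
    archContainer X hlog j =
      ArchPacket.polydisc (ArchPresentation.J (T := thetaIndex X) (Sum.inl ()) j)
        fun _ => Real.pi ^ Fintype.card ((thetaIndex X).Caps j) := by
  rw [ArchPacket.polydisc_eq_pi]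
  rfl

/-- The distinguished point `Φ₀(⊗_i (π)_v)` — the image of the tensor of maximal-length shell elements
([IUTchIV] Step (vii): the possible images contain "the elements of `M_I` obtained by forming the tensor product of
elements of the log-shells"). [claim: Mochizuki2012, status: disputed] -/
def archMaxPoint (j : (thetaIndex X).Label) :
    ∀ s : factorIdxDHArch X hlog j (.inl ()), factorFieldDHArch X hlog j (.inl ()) s :=
  (ArchPresentation.Φ₀ (T := thetaIndex X) (Sum.inl ()) j :
      ArchPresentation.X (T := thetaIndex X) (Sum.inl ()) j →
        (ArchPresentation.J (T := thetaIndex X) (Sum.inl ()) j → ℂ))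
    (tprod ℝ fun (_ : (thetaIndex X).Caps j) (_ : (thetaIndex X).Fibre (Sum.inl ())) => (Real.pi : ℂ))

/-- Every coordinate of the distinguished point has norm `π^{|S^±_{j+1}|}` (L5-t7 `norm_coord_tprod_const`).
[claim: Mochizuki2012, status: disputed] -/
theorem norm_archMaxPoint (j : (thetaIndex X).Label) (s : factorIdxDHArch X hlog j (.inl ())) :
    ‖archMaxPoint X hlog j s‖ = Real.pi ^ Fintype.card ((thetaIndex X).Caps j) := by
  classical
  exact norm_coord_tprod_const (ArchPresentation.Φ₀ (T := thetaIndex X) (Sum.inl ()) j) Real.pi_pos.le s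

/-- The container is `Φ₀(π^{|I|}·B_I)` (L5-t7 `image_pi_pow_smul_ball`). [claim: Mochizuki2012, status: disputed] -/
theorem archContainer_eq_image (j : (thetaIndex X).Label) :
    archContainer X hlog j =
      (ArchPresentation.Φ₀ (T := thetaIndex X) (Sum.inl ()) j :
          ArchPresentation.X (T := thetaIndex X) (Sum.inl ()) j →
            (ArchPresentation.J (T := thetaIndex X) (Sum.inl ()) j → ℂ)) ''
        (Real.pi ^ Fintype.card ((thetaIndex X).Caps j) • ball (ArchPresentation.Φ₀ (T := thetaIndex X) (Sum.inl ()) j)) :=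
  (image_pi_pow_smul_ball (ArchPresentation.Φ₀ (T := thetaIndex X) (Sum.inl ()) j)).symm

variable {thetaBox}

/-- Boxes inside the container are bounded and — containing the distinguished point — nondegenerate, so
`HullDefined j ∞` (by `hullDefined_settingDHVolArch_inl`). [claim: Mochizuki2012, status: disputed] -/
theorem hullDefined_settingDHVolArch_inl_of_container (j : (thetaIndex X).Label)
    (hsub : (⋃ m : ℤ, thetaBox m (thetaPilotObject sig split) j (.inl ())) ⊆ archContainer X hlog j)
    (hmem : archMaxPoint X hlog j ∈ ⋃ m : ℤ, thetaBox m (thetaPilotObject sig split) j (.inl ())) :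
    (settingDHVolArch X hlog hc M archPk archSub Ψ act Mmod region n lat sig split qData thetaBox qCentre hq
      hfin).HullDefined j (.inl ()) :=
  hullDefined_settingDHVolArch_inl X hlog hc M archPk archSub Ψ act Mmod region n lat sig split qData thetaBox
    qCentre hq hfin j ((isBounded_polydisc _ _).subset hsub)
    fun s => ⟨_, hmem, by
      rw [← norm_ne_zero_iff, norm_archMaxPoint]
      exact (pow_pos Real.pi_pos _).ne'⟩

/-- The image under `e` of the union of ALL possible images at `(j, ∞)` lies in `π^{|I|}·B_I` (the whole
(Ind1)/(Ind2)-orbit of the (Ind3)-region stays in `e⁻¹(π^{|I|}·B_I)`, p418920 `family_image_ballPk`) and contains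
the tensor `⊗_i (π)_v`. [claim: Mochizuki2012, status: disputed] -/
theorem image_sUnion_possibleImages_inl (j : (thetaIndex X).Label)
    (hsub : (⋃ m : ℤ, thetaBox m (thetaPilotObject sig split) j (.inl ())) ⊆ archContainer X hlog j)
    (hmem : archMaxPoint X hlog j ∈ ⋃ m : ℤ, thetaBox m (thetaPilotObject sig split) j (.inl ())) :
    (archPresentationDH X logv hc).comparison j ''
          ⋃₀ (settingDHVolArch X hlog hc M archPk archSub Ψ act Mmod region n lat sig split qData thetaBox qCentre hq
            hfin).possibleImages j (.inl ()) ⊆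
        Real.pi ^ Fintype.card ((thetaIndex X).Caps j) • ball (ArchPresentation.Φ₀ (T := thetaIndex X) (Sum.inl ()) j) ∧
      (tprod ℝ fun (_ : (thetaIndex X).Caps j) (_ : (thetaIndex X).Fibre (Sum.inl ())) => (Real.pi : ℂ)) ∈
        (archPresentationDH X logv hc).comparison j ''
          ⋃₀ (settingDHVolArch X hlog hc M archPk archSub Ψ act Mmod region n lat sig split qData thetaBox qCentre hq
            hfin).possibleImages j (.inl ()) := by
  set A := archPresentationDH X logv hc
  set P := settingDHVolArch X hlog hc M archPk archSub Ψ act Mmod region n lat sig split qData thetaBox qCentre hq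
    hfin
  set r : ℝ := Real.pi ^ Fintype.card ((thetaIndex X).Caps j)
  -- the (Ind3)-region lies in `ballPk r`
  have h3 : P.thetaRegion3 j (.inl ()) ⊆ A.ballPk j r := by
    rw [thetaRegion3_settingDHVolArch, factorMapDHArch_inl, A.ballPk_eq_preimage_polydisc j (pow_pos Real.pi_pos _).le,
      ← archContainer_eq_archPacket X hlog j]
    exact Set.preimage_mono hsub
  have hU : ⋃₀ P.possibleImages j (.inl ()) ⊆ A.ballPk j r :=
    P.sUnion_possibleImages_subset (fun Φ hΦ => A.family_image_ballPk hΦ j r) h3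
  refine ⟨?_, ?_⟩
  · rintro _ ⟨x, hx, rfl⟩
    exact hU hx
  · -- the tensor of maximal-length shell elements is the comparison of a point of the (Ind3)-region
    obtain ⟨x, hx⟩ := A.comparison_surjective j
      (tprod ℝ fun (_ : (thetaIndex X).Caps j) (_ : (thetaIndex X).Fibre (Sum.inl ())) => (Real.pi : ℂ))
    refine ⟨x, P.thetaRegion3_subset_sUnion j (.inl ()) ?_, hx⟩
    rw [thetaRegion3_settingDHVolArch, factorMapDHArch_inl]
    show (ArchPresentation.Φ₀ (T := thetaIndex X) (Sum.inl ()) j :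
        ArchPresentation.X (T := thetaIndex X) (Sum.inl ()) j →
          (ArchPresentation.J (T := thetaIndex X) (Sum.inl ()) j → ℂ)) (A.comparison j x) ∈
      ⋃ m : ℤ, thetaBox m (thetaPilotObject sig split) j (.inl ())
    rw [hx]
    exact hmem

/-- **The hull `^{n,∘}𝒰_{j,∞}` at the archimedean place IS `e⁻¹(π^{j+1}·B_I)`** — [IUTchIV] Step (vii) "`π^{j+1}·B_I`
serves as a container for the union of possible images of a Θ-pilot object" in its sharp form (L5-t7
`holomorphicHull_image_eq`: the holomorphic hull of any region of `M_I` inside the container containing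
`⊗_i (π)_v` is the container), read at the assembled real setting. [claim: Mochizuki2012, status: disputed] -/
theorem thetaHull_settingDHVolArch_inl (j : (thetaIndex X).Label)
    (hsub : (⋃ m : ℤ, thetaBox m (thetaPilotObject sig split) j (.inl ())) ⊆ archContainer X hlog j)
    (hmem : archMaxPoint X hlog j ∈ ⋃ m : ℤ, thetaBox m (thetaPilotObject sig split) j (.inl ())) :
    (settingDHVolArch X hlog hc M archPk archSub Ψ act Mmod region n lat sig split qData thetaBox qCentre hq
        hfin).thetaHull j (.inl ()) =
      (archPresentationDH X logv hc).comparison j ⁻¹'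
        (Real.pi ^ Fintype.card ((thetaIndex X).Caps j) • ball (ArchPresentation.Φ₀ (T := thetaIndex X) (Sum.inl ()) j)) := by
  classical
  set P := settingDHVolArch X hlog hc M archPk archSub Ψ act Mmod region n lat sig split qData thetaBox qCentre hq
    hfin
  have hD := hullDefined_settingDHVolArch_inl_of_container X hlog hc M archPk archSub Ψ act Mmod region n lat sig
    split qData qCentre hq hfin j hsub hmem
  obtain ⟨hU, hπ⟩ := image_sUnion_possibleImages_inl X hlog hc M archPk archSub Ψ act Mmod region n lat sig split
    qData qCentre hq hfin j hsub hmem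
  -- unfold the hull of the pulled-back archimedean frame
  have hK : HullFrame.NormSurjective (factorFieldDHArch X hlog j (.inl ())) :=
    HullFrame.normSurjective_of_rclike ℂ _
  have hb : Bornology.IsBounded (factorMapDHArch X hlog hc j (.inl ()) '' ⋃₀ P.possibleImages j (.inl ())) := hD.1
  have hnd : IsNondegenerate (factorFieldDHArch X hlog j (.inl ()))
      (factorMapDHArch X hlog hc j (.inl ()) '' ⋃₀ P.possibleImages j (.inl ())) := hD.2
  show ((HullFrame.ofNormSurjective (factorFieldDHArch X hlog j (.inl ())) hK).comap
      (factorMapDHArch X hlog hc j (.inl ()))).hull (⋃₀ P.possibleImages j (.inl ())) = _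
  rw [HullFrame.comap_hull _ _ hb, HullFrame.ofNormSurjective_hull_eq _ hK hb hnd, factorMapDHArch_inl]
  -- `(Φ₀ ∘ e) '' ⋃₀ = Φ₀ '' (e '' ⋃₀)`, then L5-t7's hull theorem
  show (archPresentationDH X logv hc).factorCoords j ⁻¹'
      Literature.IUT.LogVolume.holomorphicHull (fun _ : ArchPresentation.J (T := thetaIndex X) (Sum.inl ()) j => ℂ)
        (((ArchPresentation.Φ₀ (T := thetaIndex X) (Sum.inl ()) j :
            ArchPresentation.X (T := thetaIndex X) (Sum.inl ()) j →
              (ArchPresentation.J (T := thetaIndex X) (Sum.inl ()) j → ℂ)) ∘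
            (archPresentationDH X logv hc).comparison j) '' ⋃₀ P.possibleImages j (.inl ())) = _
  rw [Set.image_comp, holomorphicHull_image_eq (ArchPresentation.Φ₀ (T := thetaIndex X) (Sum.inl ()) j) hU hπ]
  -- `(Φ₀ ∘ e)⁻¹ (Φ₀ (π^k·B_I)) = e⁻¹ (π^k·B_I)`
  ext x
  simp only [Set.mem_preimage, ArchPresentation.factorCoords]
  exact (ArchPresentation.Φ₀ (T := thetaIndex X) (Sum.inl ()) j).injective.mem_set_image

/-- **The archimedean local Θ-term of the honest real setting: `thetaLocal j ∞ = |S^±_{j+1}|·log π = (j+1)·log π`**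
([IUTchIV] Step (vii) p. 30 "an upper bound `(j+1)·log(π)`", here an IDENTITY for boxes inside the container
containing `Φ₀(⊗_i (π)_v)`; the trivial container of `Cor312VolumesRealAssembly` had `0` here).
[claim: Mochizuki2012, status: disputed] -/
theorem thetaLocal_settingDHVolArch_inl (j : (thetaIndex X).Label)
    (hsub : (⋃ m : ℤ, thetaBox m (thetaPilotObject sig split) j (.inl ())) ⊆ archContainer X hlog j)
    (hmem : archMaxPoint X hlog j ∈ ⋃ m : ℤ, thetaBox m (thetaPilotObject sig split) j (.inl ())) :
    (settingDHVolArch X hlog hc M archPk archSub Ψ act Mmod region n lat sig split qData thetaBox qCentre hq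
        hfin).thetaLocal j (.inl ()) =
      ((Fintype.card ((thetaIndex X).Caps j) * Real.log Real.pi : ℝ) : WithTop ℝ) := by
  have hD := hullDefined_settingDHVolArch_inl_of_container X hlog hc M archPk archSub Ψ act Mmod region n lat sig
    split qData qCentre hq hfin j hsub hmem
  unfold Setting.thetaLocal
  rw [if_pos hD, thetaHull_settingDHVolArch_inl X hlog hc M archPk archSub Ψ act Mmod region n lat sig split qData
    qCentre hq hfin j hsub hmem]
  congr 1
  exact logvol_thetaContainer_arch X hlog hc j

/-! ## The (Ind3)-region itself at `∞` when the boxes EXHAUST the container (the `hθ`/`hfinθ` inputs) -/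

/-- If the union of the Θ-boxes at `(j, ∞)` IS the Step (vii) container, the (Ind3)-region at `(j, ∞)` is
`e⁻¹(π^{j+1}·B_I)`. [claim: Mochizuki2012, status: disputed] -/
theorem thetaRegion3_settingDHVolArch_inl_of_eq (j : (thetaIndex X).Label)
    (heq : (⋃ m : ℤ, thetaBox m (thetaPilotObject sig split) j (.inl ())) = archContainer X hlog j) :
    (settingDHVolArch X hlog hc M archPk archSub Ψ act Mmod region n lat sig split qData thetaBox qCentre hq
        hfin).thetaRegion3 j (.inl ()) =
      (archPresentationDH X logv hc).comparison j ⁻¹'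
        (Real.pi ^ Fintype.card ((thetaIndex X).Caps j) • ball (ArchPresentation.Φ₀ (T := thetaIndex X) (Sum.inl ()) j)) := by
  rw [thetaRegion3_settingDHVolArch, factorMapDHArch_inl, heq, archContainer_eq_archPacket]
  exact ((archPresentationDH X logv hc).ballPk_eq_preimage_polydisc j (pow_pos Real.pi_pos _).le).symm

/-- … so the (Ind3)-region at `(j, ∞)` is ADMISSIBLE in the honest container (the residual `hθ` of
`bridgeHyps_settingDHVolArch` AT `∞`; p418570 `adm_thetaContainer_arch`). [claim: Mochizuki2012, status: disputed] -/
theorem adm_thetaRegion3_settingDHVolArch_inl_of_eq (j : (thetaIndex X).Label)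
    (heq : (⋃ m : ℤ, thetaBox m (thetaPilotObject sig split) j (.inl ())) = archContainer X hlog j) :
    ((situationDHVolArch X hlog hc M archPk archSub Ψ act Mmod region).D n).Adm j (.inl ())
      ((settingDHVolArch X hlog hc M archPk archSub Ψ act Mmod region n lat sig split qData thetaBox qCentre hq
        hfin).thetaRegion3 j (.inl ())) := by
  rw [thetaRegion3_settingDHVolArch_inl_of_eq X hlog hc M archPk archSub Ψ act Mmod region n lat sig split qData
    qCentre hq hfin j heq]
  exact adm_thetaContainer_arch X hlog hc j

/-- … with log-volume EXACTLY `|S^±_{j+1}|·log π` (the `∞`-summand of the support of `hfinθ`; p418570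
`logvol_thetaContainer_arch`). [claim: Mochizuki2012, status: disputed] -/
theorem logvol_thetaRegion3_settingDHVolArch_inl_of_eq (j : (thetaIndex X).Label)
    (heq : (⋃ m : ℤ, thetaBox m (thetaPilotObject sig split) j (.inl ())) = archContainer X hlog j) :
    ((situationDHVolArch X hlog hc M archPk archSub Ψ act Mmod region).D n).logvol j (.inl ())
      ((settingDHVolArch X hlog hc M archPk archSub Ψ act Mmod region n lat sig split qData thetaBox qCentre hq
        hfin).thetaRegion3 j (.inl ())) =
      Fintype.card ((thetaIndex X).Caps j) * Real.log Real.pi := by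
  rw [thetaRegion3_settingDHVolArch_inl_of_eq X hlog hc M archPk archSub Ψ act Mmod region n lat sig split qData
    qCentre hq hfin j heq]
  exact logvol_thetaContainer_arch X hlog hc j

/-- If the boxes exhaust the container then also the HULL is the container and `thetaLocal j ∞ = (j+1)·log π`
(the container contains `Φ₀(⊗_i (π)_v)`: all its coordinates have norm `π^{j+1}`). [claim: Mochizuki2012, status: disputed] -/
theorem thetaLocal_settingDHVolArch_inl_of_eq (j : (thetaIndex X).Label)
    (heq : (⋃ m : ℤ, thetaBox m (thetaPilotObject sig split) j (.inl ())) = archContainer X hlog j) :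
    (settingDHVolArch X hlog hc M archPk archSub Ψ act Mmod region n lat sig split qData thetaBox qCentre hq
        hfin).thetaLocal j (.inl ()) =
      ((Fintype.card ((thetaIndex X).Caps j) * Real.log Real.pi : ℝ) : WithTop ℝ) :=
  thetaLocal_settingDHVolArch_inl X hlog hc M archPk archSub Ψ act Mmod region n lat sig split qData qCentre hq hfin j
    heq.le (by
      rw [heq]
      exact (Literature.IUT.LogVolume.mem_polydisc _).2 fun s => (norm_archMaxPoint X hlog j s).le)

end Setting

end Real

end Thm311

end IUTFork

end Summit.ABC

end
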